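import Summits.KontsevichZagierPeriods.KontsevichZagierPeriods.Theses.HyperbolicBloch
import Literature.NumberTheory.Transcendental.KZKernelConjectureForms
import Literature.NumberTheory.Transcendental.KZProduct
import Literature.NumberTheory.Transcendental.KZCalculusProofs
import Literature.NumberTheory.Transcendental.KZLogCalculusProofs

/-!
# `OffTetraSectorKernel` (stmt-KontsevichZagierPeriods-10557) — negative side: load-bearing hypotheses, shape of a kill

cdisprove (refuter) lemmas for the crux `HyperbolicBloch.OffTetraSectorKernel` — the kernel form of
Conjecture 1 with the `ℚ̄`-ideal-tetrahedron value-relators adjoined: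
`∀ c, KZ.eval c = 0 → c ∈ KZ.relations ⊔ closure (tetraRelators T)` for the standard family `T`.
Commentary and the full census live in the crux work file `Cruxes/OffTetraSectorKernel/Disproof.lean`.
Sorry-free; axioms ⊆ {propext, Classical.choice, Quot.sound}.

* §1 SOUNDNESS SIDE. `sup_closure_le_ker`: for EVERY family `T`,
  `relations ⊔ closure (tetraRelators T) ≤ ker eval` (the adjoined relators cancel by definition);
  the target subgroup is proper (`sup_closure_ne_top`, it misses `[π]`).
* §2 LOAD-BEARING. `offTetraSectorKernel_false_without_evalZero` (witness `[π] = [piRep]`);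
  `offTetraSectorKernel_false_without_relations` (the dimension-`0` coefficient sum `dimZeroCoeff`
  kills every tetra relator — all live in dimension `3` — but not the kernel element `[∅₀]`);
  `offTetraSectorKernelWithoutFamily_iff_kzKernelConjecture` (with the pinning hypothesis
  `∀ z, T z = {…}` deleted, the instance `T ≡ ∅` collapses the closure into `relations`
  — null domains are relations, tree lemma `KZ.of_mem_relations_of_volume_eq_zero` — and the statement becomes
  `KZKernelConjecture` verbatim).
* §2b RULE (3) IS LOAD-BEARING. `offTetraSectorKernel_false_without_newtonLeibniz`: with the
  Newton–Leibniz move deleted (kernel ⊆ closure((1a) ∪ (1b) ∪ (2)) ⊔ closure tetra) the statement is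
  FALSE — `dimTwoEval` (evaluate the dimension-`2` generators only) is an invariant of the three
  dimension-preserving moves and of the (dimension-`3`) tetra relators, and is `−π` on the kernel
  element `[piRep.slab 0] − [piRep]` (itself ONE rule-(3) instance). The off-sector remainder is not
  reachable by the scissors-type sub-calculus that suffices for the sector.
* §3 SHAPE OF A KILL. `not_offTetraSectorKernel_of_invariant`: an additive invariant of the four
  move sets AND of the tetra relators, non-zero on a kernel element, refutes the crux;
  `not_kontsevichZagierPeriods_of_not_offTetraSectorKernel`: any kill is a disproof of the summit
  (the summit gives `KZKernelConjecture` by the tree's `kzKernelConjecture_iff_isRational`, and the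
  kernel conjecture gives the crux by `AddSubgroup.mem_sup_left`).
* §4 REFUTED STRENGTHENING. `not_ker_le_closure_tetraRelators`: the tetra relators alone do not
  exhaust the kernel.

[Kontsevich–Zagier 2001, §1.2, rules (1)–(3) and Conjecture 1]
-/

noncomputable section

set_option linter.dupNamespace false

open MeasureTheory Set
open Literature.NumberTheory.Transcendental
open Summit.KontsevichZagierPeriods.KontsevichZagierPeriods.Theses.HyperbolicBloch
  (OffTetraSectorKernel)

namespace Summit.KontsevichZagierPeriods.HyperbolicBloch.OffTetraSectorKernelNegative

/-! ### §0 The adjoined relators, named -/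

/-- The standard upper-half-space model of the ideal tetrahedron `(∞, 0, 1, z)`: the family pinned
by the hypothesis `∀ z, T z = {…}` of the crux. [cite: KontsevichZagier2001, §1.1] -/
def stdFamily : ℂ → Set (Fin 3 → ℝ) := fun z =>
  {p | 0 < p 1 ∧ z.re * p 1 < z.im * p 0 ∧ z.im * (p 0 - 1) < (z.re - 1) * p 1 ∧ 0 < p 2 ∧
    0 < z.im * (p 0 ^ 2 + p 1 ^ 2 + p 2 ^ 2 - p 0) + (z.re - Complex.normSq z) * p 1}

/-- The adjoined value-relators of a family `T` — verbatim the set under `AddSubgroup.closure` in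
the crux: `ℤ`-combinations of representations on the `T z` (`z` algebraic, `Im z > 0`, integrand
`t⁻³` on `T z`) whose values cancel. [cite: KontsevichZagier2001, §1.2] -/
def tetraRelators (T : ℂ → Set (Fin 3 → ℝ)) : Set KZ.FormalRep :=
  {d | ∃ ρ : ℂ → KZ.IntegralRep 3,
    (∀ z, IsAlgebraic ℚ z → 0 < z.im → (ρ z).domain = T z ∧
      Set.EqOn (ρ z).integrand (fun p => 1 / p 2 ^ 3) (T z)) ∧
    ∃ (k : ℕ) (z : Fin k → ℂ) (n : Fin k → ℤ), (∀ i, IsAlgebraic ℚ (z i)) ∧ (∀ i, 0 < (z i).im) ∧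
      ∑ i, (n i : ℝ) * (ρ (z i)).value = 0 ∧ d = ∑ i, n i • KZ.of (ρ (z i))}

/-! ### §1 Soundness side -/

/-- Every adjoined relator evaluates to `0`, for ANY family `T`. [cite: KontsevichZagier2001, §1.2] -/
theorem tetraRelators_subset_ker (T : ℂ → Set (Fin 3 → ℝ)) :
    tetraRelators T ⊆ (KZ.eval.ker : Set KZ.FormalRep) := by
  rintro d ⟨ρ, -, k, z, n, -, -, hsum, rfl⟩
  simp only [SetLike.mem_coe, AddMonoidHom.mem_ker, map_sum, map_zsmul, KZ.eval_of, zsmul_eq_mul]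
  exact hsum

/-- `relations ⊔ closure (tetraRelators T) ≤ ker eval` (soundness of the calculus,
`KZ.relations_le_ker_eval_holds`, plus `tetraRelators_subset_ker`): the crux is the reverse
inclusion, and is not trivialised by an overflowing closure. [cite: KontsevichZagier2001, §1.2] -/
theorem sup_closure_le_ker (T : ℂ → Set (Fin 3 → ℝ)) :
    KZ.relations ⊔ AddSubgroup.closure (tetraRelators T) ≤ KZ.eval.ker :=
  sup_le KZ.relations_le_ker_eval_holds ((AddSubgroup.closure_le _).mpr (tetraRelators_subset_ker T))

/-- The target subgroup is proper: it misses `[piRep]` (value `π ≠ 0`). [folklore] -/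
theorem sup_closure_ne_top (T : ℂ → Set (Fin 3 → ℝ)) :
    KZ.relations ⊔ AddSubgroup.closure (tetraRelators T) ≠ ⊤ := by
  intro h
  have hmem : KZ.of KZ.piRep ∈ KZ.relations ⊔ AddSubgroup.closure (tetraRelators T) := by
    rw [h]; trivial
  have h0 : KZ.eval (KZ.of KZ.piRep) = 0 := sup_closure_le_ker T hmem
  rw [KZ.eval_of, KZ.piRep_value] at h0
  exact Real.pi_ne_zero h0

/-! ### §2 Load-bearing hypotheses -/

/-- The crux WITHOUT the hypothesis `KZ.eval c = 0`. -/
def OffTetraSectorKernelWithoutEvalZero : Prop :=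
  ∀ (T : ℂ → Set (Fin 3 → ℝ)), (∀ z, T z = {p | 0 < p 1 ∧ z.re * p 1 < z.im * p 0 ∧
    z.im * (p 0 - 1) < (z.re - 1) * p 1 ∧ 0 < p 2 ∧
    0 < z.im * (p 0 ^ 2 + p 1 ^ 2 + p 2 ^ 2 - p 0) + (z.re - Complex.normSq z) * p 1}) →
  ∀ c : KZ.FormalRep, c ∈ KZ.relations ⊔ AddSubgroup.closure (tetraRelators T)

/-- **Any proof must use `eval c = 0`**: `c = [piRep]` (closed unit disc, integrand `1`, value
`π`) is outside the target subgroup, which lies in `ker eval` (§1). [folklore] -/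
theorem offTetraSectorKernel_false_without_evalZero : ¬ OffTetraSectorKernelWithoutEvalZero := by
  intro h
  have hmem := h stdFamily (fun _ => rfl) (KZ.of KZ.piRep)
  have h0 : KZ.eval (KZ.of KZ.piRep) = 0 := sup_closure_le_ker stdFamily hmem
  rw [KZ.eval_of, KZ.piRep_value] at h0
  exact Real.pi_ne_zero h0

/-- The crux WITHOUT the summand `KZ.relations ⊔`: kernel elements lie in the closure of the
tetrahedral value-relators alone. -/
def OffTetraSectorKernelWithoutRelations : Prop :=
  ∀ (T : ℂ → Set (Fin 3 → ℝ)), (∀ z, T z = {p | 0 < p 1 ∧ z.re * p 1 < z.im * p 0 ∧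
    z.im * (p 0 - 1) < (z.re - 1) * p 1 ∧ 0 < p 2 ∧
    0 < z.im * (p 0 ^ 2 + p 1 ^ 2 + p 2 ^ 2 - p 0) + (z.re - Complex.normSq z) * p 1}) →
  ∀ c : KZ.FormalRep, KZ.eval c = 0 → c ∈ AddSubgroup.closure (tetraRelators T)

/-- The dimension-`0` coefficient sum: the additive map sending a generator `[r]` of dimension `n`
to `1` if `n = 0` and to `0` otherwise. [folklore] -/
def dimZeroCoeff : KZ.FormalRep →+ ℤ :=
  FreeAbelianGroup.lift fun p => if p.1 = 0 then 1 else 0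

/-- `dimZeroCoeff` on a generator. [folklore] -/
@[simp] theorem dimZeroCoeff_of {n : ℕ} (r : KZ.IntegralRep n) :
    dimZeroCoeff (KZ.of r) = if n = 0 then 1 else 0 :=
  FreeAbelianGroup.lift_apply_of _ _

/-- Tetra relators (all in dimension `3`) have dimension-`0` coefficient sum `0`. [folklore] -/
theorem dimZeroCoeff_eq_zero_of_mem_tetraRelators (T : ℂ → Set (Fin 3 → ℝ)) {d : KZ.FormalRep}
    (hd : d ∈ tetraRelators T) : dimZeroCoeff d = 0 := by
  obtain ⟨ρ, -, k, z, n, -, -, -, rfl⟩ := hd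
  simp

/-- The closure of the tetra relators lies in the kernel of `dimZeroCoeff`. [folklore] -/
theorem closure_tetraRelators_le_ker_dimZeroCoeff (T : ℂ → Set (Fin 3 → ℝ)) :
    AddSubgroup.closure (tetraRelators T) ≤ dimZeroCoeff.ker :=
  (AddSubgroup.closure_le _).mpr fun _ hd => dimZeroCoeff_eq_zero_of_mem_tetraRelators T hd

/-- **Any proof must use the move subgroup**: the kernel element `[∅₀]` (empty representation in
dimension `0`, value `0`; it IS a relation, `KZ.IntegralRep.of_empty_mem_relations`) has
`dimZeroCoeff = 1`, so it is not in the closure of the tetra relators. [folklore] -/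
theorem offTetraSectorKernel_false_without_relations : ¬ OffTetraSectorKernelWithoutRelations := by
  intro h
  have hmem := h stdFamily (fun _ => rfl) (KZ.of (KZ.IntegralRep.empty 0)) (by simp)
  have h0 := closure_tetraRelators_le_ker_dimZeroCoeff stdFamily hmem
  rw [AddMonoidHom.mem_ker, dimZeroCoeff_of] at h0
  simp at h0

/-- The crux WITHOUT the pinning hypothesis `∀ z, T z = {…}` (the family left free). -/
def OffTetraSectorKernelWithoutFamily : Prop :=
  ∀ (T : ℂ → Set (Fin 3 → ℝ)) (c : KZ.FormalRep),
    KZ.eval c = 0 → c ∈ KZ.relations ⊔ AddSubgroup.closure (tetraRelators T)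

/-- For the EMPTY family every adjoined relator is already a relation (null domains). [folklore] -/
theorem closure_tetraRelators_empty_le :
    AddSubgroup.closure (tetraRelators fun _ => ∅) ≤ KZ.relations := by
  refine (AddSubgroup.closure_le _).mpr ?_
  rintro d ⟨ρ, hρ, k, z, n, halg, him, -, rfl⟩
  refine AddSubgroup.sum_mem _ fun i _ => AddSubgroup.zsmul_mem _ ?_ _
  exact KZ.of_mem_relations_of_volume_eq_zero _ (by rw [(hρ (z i) (halg i) (him i)).1, measure_empty])

/-- **Deleting the pinning hypothesis turns the crux into `KZKernelConjecture` verbatim** (instance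
`T ≡ ∅` for `→`, `AddSubgroup.mem_sup_left` for `←`): the family hypothesis carries exactly the
weight of the Bloch–Wigner sector and no more. [cite: KontsevichZagier2001, §1.2 Conjecture 1] -/
theorem offTetraSectorKernelWithoutFamily_iff_kzKernelConjecture :
    OffTetraSectorKernelWithoutFamily ↔ KZKernelConjecture := by
  constructor
  · intro h c hc
    exact sup_le le_rfl closure_tetraRelators_empty_le (h _ c hc)
  · intro h T c hc
    exact AddSubgroup.mem_sup_left (h c hc)

/-! ### §2b Rule (3) is load-bearing: evaluation in dimension two only -/

/-- Evaluation of the dimension-`2` generators only: `[r] ↦ value r` if `r` has dimension `2`,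
`↦ 0` otherwise. It is an invariant of the three dimension-preserving moves (1a), (1b), (2) and
of the tetra relators (dimension `3`), but not of Newton–Leibniz. [folklore] -/
def dimTwoEval : KZ.FormalRep →+ ℝ :=
  FreeAbelianGroup.lift fun p => if p.1 = 2 then p.2.value else 0

/-- `dimTwoEval` on a generator. [folklore] -/
@[simp] theorem dimTwoEval_of {n : ℕ} (r : KZ.IntegralRep n) :
    dimTwoEval (KZ.of r) = if n = 2 then r.value else 0 :=
  FreeAbelianGroup.lift_apply_of _ _

/-- On a three-term combination in one dimension, `dimTwoEval` is `eval` or `0`. [folklore] -/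
theorem dimTwoEval_sub_sub {n : ℕ} (r r₁ r₂ : KZ.IntegralRep n) :
    dimTwoEval (KZ.of r - KZ.of r₁ - KZ.of r₂) =
      if n = 2 then KZ.eval (KZ.of r - KZ.of r₁ - KZ.of r₂) else 0 := by
  simp only [map_sub, dimTwoEval_of, KZ.eval_of]
  split_ifs <;> simp

/-- On a two-term combination in one dimension, `dimTwoEval` is `eval` or `0`. [folklore] -/
theorem dimTwoEval_sub {n : ℕ} (r r' : KZ.IntegralRep n) :
    dimTwoEval (KZ.of r - KZ.of r') = if n = 2 then KZ.eval (KZ.of r - KZ.of r') else 0 := by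
  simp only [map_sub, dimTwoEval_of, KZ.eval_of]
  split_ifs <;> simp

/-- Domain additivity preserves `dimTwoEval`. [cite: KontsevichZagier2001, §1.2 rule (1)] -/
theorem dimTwoEval_eq_zero_of_mem_domainAddRel {c : KZ.FormalRep} (hc : c ∈ KZ.domainAddRel) :
    dimTwoEval c = 0 := by
  have h0 : KZ.eval c = 0 := KZ.eval_eq_zero_of_mem_domainAddRel_holds hc
  obtain ⟨n, r, r₁, r₂, -, -, -, -, rfl⟩ := hc
  rw [dimTwoEval_sub_sub, h0]
  simp

/-- Integrand additivity preserves `dimTwoEval`. [cite: KontsevichZagier2001, §1.2 rule (1)] -/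
theorem dimTwoEval_eq_zero_of_mem_integrandAddRel {c : KZ.FormalRep} (hc : c ∈ KZ.integrandAddRel) :
    dimTwoEval c = 0 := by
  have h0 : KZ.eval c = 0 := KZ.eval_eq_zero_of_mem_integrandAddRel_holds hc
  obtain ⟨n, r, r₁, r₂, -, -, -, rfl⟩ := hc
  rw [dimTwoEval_sub_sub, h0]
  simp

/-- Change of variables preserves `dimTwoEval`. [cite: KontsevichZagier2001, §1.2 rule (2)] -/
theorem dimTwoEval_eq_zero_of_mem_changeOfVariablesRel {c : KZ.FormalRep}
    (hc : c ∈ KZ.changeOfVariablesRel) : dimTwoEval c = 0 := by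
  have h0 : KZ.eval c = 0 := KZ.eval_eq_zero_of_mem_changeOfVariablesRel_holds hc
  obtain ⟨n, r, r', Φ, Φ', -, -, -, -, -, rfl⟩ := hc
  rw [dimTwoEval_sub, h0]
  simp

/-- Tetra relators (dimension `3`) have `dimTwoEval = 0`. [folklore] -/
theorem dimTwoEval_eq_zero_of_mem_tetraRelators (T : ℂ → Set (Fin 3 → ℝ)) {d : KZ.FormalRep}
    (hd : d ∈ tetraRelators T) : dimTwoEval d = 0 := by
  obtain ⟨ρ, -, k, z, n, -, -, -, rfl⟩ := hd
  simp

/-- The crux WITH RULE (3) DELETED: kernel elements lie in the subgroup generated by the three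
dimension-preserving moves (1a), (1b), (2) together with the tetra relators. -/
def OffTetraSectorKernelWithoutNewtonLeibniz : Prop :=
  ∀ (T : ℂ → Set (Fin 3 → ℝ)), (∀ z, T z = {p | 0 < p 1 ∧ z.re * p 1 < z.im * p 0 ∧
    z.im * (p 0 - 1) < (z.re - 1) * p 1 ∧ 0 < p 2 ∧
    0 < z.im * (p 0 ^ 2 + p 1 ^ 2 + p 2 ^ 2 - p 0) + (z.re - Complex.normSq z) * p 1}) →
  ∀ c : KZ.FormalRep, KZ.eval c = 0 →
    c ∈ AddSubgroup.closure (KZ.domainAddRel ∪ KZ.integrandAddRel ∪ KZ.changeOfVariablesRel) ⊔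
      AddSubgroup.closure (tetraRelators T)

/-- **Any proof of the crux must use the Newton–Leibniz move.** The kernel element
`[piRep.slab 0] − [piRep]` (the cylinder `{x²+y² ≤ 1} × [0,1]` with integrand `1` against the
disc; it IS one rule-(3) instance, `KZ.IntegralRep.of_slab_sub_of_mem_newtonLeibnizRel`) has
`dimTwoEval = −π ≠ 0`, while `dimTwoEval` kills (1a), (1b), (2) and every tetra relator.
In particular the off-sector remainder is NOT reachable by the scissors-type sub-calculus that
suffices for the sector itself (route rationale: "the line needs no Newton–Leibniz move"). [folklore] -/
theorem offTetraSectorKernel_false_without_newtonLeibniz :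
    ¬ OffTetraSectorKernelWithoutNewtonLeibniz := by
  intro h
  have hNL := KZ.IntegralRep.of_slab_sub_of_mem_newtonLeibnizRel KZ.piRep 0
  have hc : KZ.eval (KZ.of (KZ.piRep.slab 0) - KZ.of KZ.piRep) = 0 :=
    KZ.relations_le_ker_eval_holds (KZ.newtonLeibnizRel_subset_relations hNL)
  have hmem := h stdFamily (fun _ => rfl) _ hc
  have hle : AddSubgroup.closure (KZ.domainAddRel ∪ KZ.integrandAddRel ∪ KZ.changeOfVariablesRel) ⊔
      AddSubgroup.closure (tetraRelators stdFamily) ≤ dimTwoEval.ker := by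
    refine sup_le ((AddSubgroup.closure_le _).mpr ?_) ((AddSubgroup.closure_le _).mpr ?_)
    · rintro x ((hx | hx) | hx)
      · exact dimTwoEval_eq_zero_of_mem_domainAddRel hx
      · exact dimTwoEval_eq_zero_of_mem_integrandAddRel hx
      · exact dimTwoEval_eq_zero_of_mem_changeOfVariablesRel hx
    · intro x hx
      exact dimTwoEval_eq_zero_of_mem_tetraRelators stdFamily hx
  have h0 := hle hmem
  rw [AddMonoidHom.mem_ker, map_sub, dimTwoEval_of, dimTwoEval_of, KZ.piRep_value] at h0
  simp at h0

/-! ### §3 Shape of a kill -/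

/-- **Template.** An additive invariant killing the four move sets and the tetra relators of the
standard family, non-zero on one kernel element, refutes the crux. [folklore] -/
theorem not_offTetraSectorKernel_of_invariant {A : Type*} [AddCommGroup A] (ι : KZ.FormalRep →+ A)
    (hmoves : ∀ c ∈ KZ.domainAddRel ∪ KZ.integrandAddRel ∪ KZ.changeOfVariablesRel ∪
      KZ.newtonLeibnizRel, ι c = 0)
    (htetra : ∀ d ∈ tetraRelators stdFamily, ι d = 0)
    (c : KZ.FormalRep) (hc : KZ.eval c = 0) (hι : ι c ≠ 0) : ¬ OffTetraSectorKernel := by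
  intro hO
  have hmem : c ∈ KZ.relations ⊔ AddSubgroup.closure (tetraRelators stdFamily) :=
    hO stdFamily (fun _ => rfl) c hc
  have hle : KZ.relations ⊔ AddSubgroup.closure (tetraRelators stdFamily) ≤ ι.ker :=
    sup_le ((AddSubgroup.closure_le _).mpr fun x hx => hmoves x hx)
      ((AddSubgroup.closure_le _).mpr fun x hx => htetra x hx)
  exact hι (hle hmem)

/-- **Universality of the quotient**: if the crux fails, the quotient map by the target subgroup is
an invariant as in `not_offTetraSectorKernel_of_invariant`; so that template is the exact shape of
any kill. [folklore] -/
theorem exists_invariant_of_not_offTetraSectorKernel (h : ¬ OffTetraSectorKernel) :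
    ∃ ι : KZ.FormalRep →+
        KZ.FormalRep ⧸ (KZ.relations ⊔ AddSubgroup.closure (tetraRelators stdFamily)),
      (∀ c ∈ KZ.domainAddRel ∪ KZ.integrandAddRel ∪ KZ.changeOfVariablesRel ∪ KZ.newtonLeibnizRel,
        ι c = 0) ∧ (∀ d ∈ tetraRelators stdFamily, ι d = 0) ∧
      ∃ c : KZ.FormalRep, KZ.eval c = 0 ∧ ι c ≠ 0 := by
  set N := KZ.relations ⊔ AddSubgroup.closure (tetraRelators stdFamily) with hN
  refine ⟨QuotientAddGroup.mk' N, ?_, ?_, ?_⟩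
  · intro c hc
    exact (QuotientAddGroup.eq_zero_iff c).mpr
      (AddSubgroup.mem_sup_left (AddSubgroup.subset_closure hc))
  · intro d hd
    exact (QuotientAddGroup.eq_zero_iff d).mpr
      (AddSubgroup.mem_sup_right (AddSubgroup.subset_closure hd))
  · by_contra hall
    push Not at hall
    apply h
    intro T hT c hc
    obtain rfl : T = stdFamily := funext hT
    exact (QuotientAddGroup.eq_zero_iff c).mp (hall c hc)

/-- **Any kill of the crux is a disproof of the summit**: the summit is the KZ-literal form of
`KZKernelConjecture` (`kzKernelConjecture_iff_isRational`), and the kernel conjecture puts every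
kernel element in `relations ≤ relations ⊔ closure _`. [cite: KontsevichZagier2001, §1.2 Conjecture 1] -/
theorem not_kontsevichZagierPeriods_of_not_offTetraSectorKernel (h : ¬ OffTetraSectorKernel) :
    ¬ _root_.KontsevichZagierPeriods := by
  intro hS
  have hk : KZKernelConjecture := kzKernelConjecture_iff_isRational.mpr hS
  exact h fun T _ c hc => AddSubgroup.mem_sup_left (hk c hc)

/-! ### §4 Refuted strengthening -/

/-- The tetra relators alone do not exhaust the kernel (witness `[∅₀]`, invariant `dimZeroCoeff`).
[folklore] -/
theorem not_ker_le_closure_tetraRelators (T : ℂ → Set (Fin 3 → ℝ)) :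
    ¬ (KZ.eval.ker ≤ AddSubgroup.closure (tetraRelators T)) := by
  intro h
  have hmem : KZ.of (KZ.IntegralRep.empty 0) ∈ KZ.eval.ker := by simp [AddMonoidHom.mem_ker]
  have h0 := closure_tetraRelators_le_ker_dimZeroCoeff T (h hmem)
  rw [AddMonoidHom.mem_ker, dimZeroCoeff_of] at h0
  simp at h0

end Summit.KontsevichZagierPeriods.HyperbolicBloch.OffTetraSectorKernelNegative
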